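import Summits.CriticalPhenomena.PercolationContinuityZ3.Theorems.PercShatteringRaceNearLinearTwoClusterDecayStubVdbdGoodPath
import Summits.CriticalPhenomena.PercolationContinuityZ3.Theorems.PercShatteringRaceNearLinearTwoClusterDecayStubVdbdAxisPaths
import Summits.CriticalPhenomena.PercolationContinuityZ3.Theorems.PercShatteringRaceNearLinearTwoClusterDecayStubVdbdCovering
import Summits.CriticalPhenomena.PercolationContinuityZ3.Theorems.PercShatteringRaceNearLinearTwoClusterDecayStubVdbdChain
import HarnessLib

/-!
# Crux `PercShatteringRace.NearLinearTwoClusterDecay` (stmt-CriticalPhenomena-5785) — § Point-to-point frontier, assembly: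
# van den Berg–Don 2020, Theorem 1 / Corollary 2 for bond percolation on `ℤ³` at `p_c`

Certificate file of the line `pair-decay-long-arms-dense` (lead c13); lands with `--supports stmt-CriticalPhenomena-5785`.
It assembles the four landed § V stubs V1 `stub_vdbdGoodPath` (p163572), V2 `stub_vdbdAxisPaths` (p163280), V3b
`stub_vdbdCovering` (p164298, itself using V3a `stub_vdbdCubeSurj` p163009) and V4 `stub_vdbdChain` (p163031) into

* `critPointToPoint_lower` — **van den Berg–Don 2020, Theorem 1 / Proposition 4 (bond `ℤ³`)**: there is `c > 0` with
  `P_{p_c}(0 ↔ x in Λ_{4n}) ≥ c n^{-9}` for every `n ≥ 1` and every `x ∈ Λ_n` (print: site percolation on `ℤ^d`, exponent `d²`,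
  box `Λ(4‖x‖)`; the proof is verbatim for bond percolation);
* `critPairConnLower9` — **Corollary 2 (bond `ℤ³`)**: `P_{p_c}(a ↔ b in Λ_{9n}) ≥ c' n^{-9}` for all `a, b ∈ Λ_n`, `n ≥ 1`
  (translation by `a`, `b - a ∈ Λ_{2n}`, `a + Λ_{8n} ⊆ Λ_{9n}`).

This is the best pointwise two-point lower bound at criticality in dimensions `3 ≤ d ≤ 6` in print (Cerf 2015 Lemma 6.1:
exponent `2d(d-1) = 12`, tree `Theorems.stub_critPairConnLower`, p144917); it is the `e = 9` input of the lossy steps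
`Theorems.stub_aspectOfTwoArmBdryWide` / `Theorems.stub_pairAspectOfTwoArmWide` (frontier certificates in
`…NearLinearTwoClusterDecayCritFrontier38.lean`).  Literature-grade content (a published theorem, fully proved): the six files
of § V import only `Literature.*` / `Mathlib.*` apart from each other, so a librarian can re-home them verbatim under
`Literature/Probability/Percolation/` (suggested: `CriticalPointToPointLowerBound.lean`).

## Proof (van den Berg–Don 2020, §2)

With `q_n := 1/(6|Λ_n|)` call `v ∈ Λ_n` good if `P_{p_c}(0 ↔ v in Λ_n) ≥ q_n`.  V1 (Lemma 8(b), from Duminil-Copin–Tassion's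
`φ_{p_c}(S) ≥ 1` for general finite `S ∋ 0`) and V2 (Lemmas 8(a), 10: lattice symmetries) give for each axis a sequence of good points
across `Λ_n` with `ℓ¹`-steps `≤ 1`; V3b (Lemma 14 via the Poincaré–Miranda Lemma 18 = V3a) writes every lattice `x ∈ [0,n]³` as
`z₁ + z₂ + z₃ + (≤ one lattice step)` with `z_b` coordinatewise-signed copies of points of the sequences — good again by the sign
symmetry (`real_openConnIn_signedPerm_box`) and in `Λ_n` (`signedPerm_mem_box_iff`); V4 (Lemma 16: Harris–FKG chaining and
translation invariance) then gives `P_{p_c}(0 ↔ x in Λ_{4n}) ≥ p_c q_n³ ≥ c n^{-9}`; general `x ∈ Λ_n` by the sign symmetry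
`x ↦ |x|`; Corollary 2 by translation (`real_openConnIn_shift_box`) and monotonicity in the box (`openConnIn_mono`).

## References

* J. van den Berg, H. Don, *A lower bound for point-to-point connection probabilities in critical percolation*,
  Electron. Commun. Probab. 25 (2020), paper no. 47 (arXiv:1912.10964): Theorem 1, Corollary 2, Proposition 4, Lemmas 8–18
  [VandenbergDon2020].
* R. Cerf, *A lower bound on the two-arms exponent for critical percolation on the lattice*, Ann. Probab. 43 (2015) 2458–2480,
  Lemma 6.1 [Cerf2015].
* H. Duminil-Copin, V. Tassion, Enseign. Math. 62 (2016) 199–206, §1 and Thm 1.1 [DuminilCopinTassionEM2016].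
-/

noncomputable section

namespace Summit.CriticalPhenomena.PercolationContinuityZ3.Theorems

namespace NearLinearTwoClusterDecayPointToPoint

open MeasureTheory
open Literature.Probability.LatticeModels Literature.Probability.Percolation

/-- **Lemma 16 for `x ∈ [0,n]³`** (van den Berg–Don 2020): `P_{p_c}(0 ↔ x in Λ_{4n}) ≥ p_c q_n³`, `q_n = 1/(6|Λ_n|)`, for every
lattice `x ∈ [0,n]³`, `n ≥ 1` — axis-crossing good paths (V1, V2), the covering (V3b), sign symmetry of goodness
(`real_openConnIn_signedPerm_box`) and the Harris–FKG chain (V4). [cite: VandenbergDon2020, Lemma 16] -/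
theorem real_pointToPoint_nonneg {n : ℕ} (hn : 1 ≤ n) {x : Site 3} (hx : ∀ c, 0 ≤ x c ∧ x c ≤ n) :
    ((criticalProbI 3 : unitInterval) : ℝ) * ((1 : ℝ) / (6 * ((box 3 n).card : ℝ))) ^ 3 ≤
      (bondPercolation (zdGraph 3) (criticalProbI 3)).real (openConnIn (↑(box 3 (4 * n)) : Set (Site 3)) 0 x) := by
  classical
  have hax := fun i => stub_vdbdAxisPaths stub_vdbdGoodPath n i
  choose L g hg0 hgL hstep hgood using hax
  obtain ⟨j, hj, ε, hsum⟩ := stub_vdbdCovering n L g hg0 hgL hstep (fun i k hk => (hgood i k hk).1) x hx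
  set z : Fin 3 → Site 3 := fun i => Site.signedPerm 1 (ε i) (g i (j i)) with hz
  have hzbox : ∀ i, z i ∈ box 3 n := fun i =>
    (signedPerm_mem_box_iff 1 (ε i)).2 (hgood i (j i) (hj i)).1
  have hzgood : ∀ i, (1 : ℝ) / (6 * ((box 3 n).card : ℝ)) ≤
      (bondPercolation (zdGraph 3) (criticalProbI 3)).real (openConnIn (↑(box 3 n) : Set (Site 3)) 0 (z i)) :=
    fun i => by
    simp only [hz]
    rw [Literature.Barriers.CriticalPhenomena.real_openConnIn_signedPerm_box]
    exact (hgood i (j i) (hj i)).2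
  have hzc : ∀ c, ∑ i, z i c = ∑ i, (ε i c : ℤ) * g i (j i) c := fun c => by
    simp [hz, Site.signedPerm_apply, Equiv.Perm.one_def]
  have hsum' : ∑ c, |x c - ∑ i, z i c| ≤ 1 := by simpa only [hzc] using hsum
  exact stub_vdbdChain n hn x z hzbox hzgood hsum'

/-- **Proposition 4 on `Λ_n`** (van den Berg–Don 2020): `P_{p_c}(0 ↔ x in Λ_{4n}) ≥ p_c q_n³` for every `x ∈ Λ_n`, `n ≥ 1` —
reduce to nonnegative coordinates by the coordinatewise sign symmetry `x ↦ |x|` (`real_openConnIn_signedPerm_box`).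
[cite: VandenbergDon2020, Proposition 4] -/
theorem real_pointToPoint {n : ℕ} (hn : 1 ≤ n) {x : Site 3} (hx : x ∈ box 3 n) :
    ((criticalProbI 3 : unitInterval) : ℝ) * ((1 : ℝ) / (6 * ((box 3 n).card : ℝ))) ^ 3 ≤
      (bondPercolation (zdGraph 3) (criticalProbI 3)).real (openConnIn (↑(box 3 (4 * n)) : Set (Site 3)) 0 x) := by
  classical
  set ε : Fin 3 → ℤˣ := fun c => if 0 ≤ x c then 1 else -1 with hε
  set x' : Site 3 := Site.signedPerm 1 ε x with hx'
  have hx'c : ∀ c, x' c = |x c| := fun c => by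
    simp only [hx', hε, Site.signedPerm_apply, Equiv.Perm.one_def, Equiv.refl_symm, Equiv.refl_apply]
    split_ifs with h
    · simp [abs_of_nonneg h]
    · simp [abs_of_neg (not_le.1 h)]
  have hx'nn : ∀ c, 0 ≤ x' c ∧ x' c ≤ n := fun c => by
    rw [hx'c]
    have h := (mem_box.1 hx) c
    exact ⟨abs_nonneg _, abs_le.2 ⟨by linarith [h.1], h.2⟩⟩
  have key := real_pointToPoint_nonneg hn hx'nn
  rwa [hx', Literature.Barriers.CriticalPhenomena.real_openConnIn_signedPerm_box] at key

/-- `q_n ≥ 1/(162 n³)` for `n ≥ 1` (`|Λ_n| = (2n+1)³ ≤ (3n)³`). [folklore] -/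
theorem q_ge {n : ℕ} (hn : 1 ≤ n) : (1 : ℝ) / (162 * (n : ℝ) ^ 3) ≤ (1 : ℝ) / (6 * ((box 3 n).card : ℝ)) := by
  have hn' : (1 : ℝ) ≤ n := by exact_mod_cast hn
  rw [card_box]
  push_cast
  rw [div_le_div_iff₀ (by positivity) (by positivity), one_mul, one_mul]
  have h1 : (2 * (n : ℝ) + 1) ≤ 3 * n := by linarith
  have h2 : (2 * (n : ℝ) + 1) ^ 3 ≤ (3 * n) ^ 3 := pow_le_pow_left₀ (by positivity) h1 3
  nlinarith [h2]

/-- `q_{2n} ≥ 1/(750 n³)` for `n ≥ 1` (`|Λ_{2n}| = (4n+1)³ ≤ (5n)³`). [folklore] -/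
theorem q_two_mul_ge {n : ℕ} (hn : 1 ≤ n) :
    (1 : ℝ) / (750 * (n : ℝ) ^ 3) ≤ (1 : ℝ) / (6 * ((box 3 (2 * n)).card : ℝ)) := by
  have hn' : (1 : ℝ) ≤ n := by exact_mod_cast hn
  rw [card_box]
  push_cast
  rw [div_le_div_iff₀ (by positivity) (by positivity), one_mul, one_mul]
  have h1 : (2 * (2 * (n : ℝ)) + 1) ≤ 5 * n := by linarith
  have h2 : (2 * (2 * (n : ℝ)) + 1) ^ 3 ≤ (5 * n) ^ 3 := pow_le_pow_left₀ (by positivity) h1 3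
  nlinarith [h2]

end NearLinearTwoClusterDecayPointToPoint

open MeasureTheory
open Literature.Probability.LatticeModels Literature.Probability.Percolation
open NearLinearTwoClusterDecayPointToPoint

/-- **van den Berg–Don 2020, Theorem 1 / Proposition 4, for bond percolation on `ℤ³` at `p_c`**: there is `c > 0` such that
`P_{p_c}(0 ↔ x in Λ_{4n}) ≥ c n^{-9}` for every `n ≥ 1` and every `x ∈ Λ_n` (`c = p_c/162³`).
[cite: VandenbergDon2020, Theorem 1] -/
theorem critPointToPoint_lower :
    ∃ c : ℝ, 0 < c ∧ ∀ n : ℕ, 1 ≤ n → ∀ x ∈ box 3 n,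
      c * (n : ℝ) ^ (-(9 : ℝ)) ≤
        (bondPercolation (zdGraph 3) (criticalProbI 3)).real (openConnIn (↑(box 3 (4 * n)) : Set (Site 3)) 0 x) := by
  have hp0 : 0 < ((criticalProbI 3 : unitInterval) : ℝ) := by
    rw [coe_criticalProbI]; exact (Grimmett1999_criticalProb_pos_lt_one_holds 3 (by norm_num)).1
  refine ⟨((criticalProbI 3 : unitInterval) : ℝ) / 162 ^ 3, by positivity, ?_⟩
  intro n hn x hx
  have hn0 : (0 : ℝ) < n := by exact_mod_cast hn
  have hq := q_ge hn
  have hq0 : (0 : ℝ) ≤ 1 / (162 * (n : ℝ) ^ 3) := by positivity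
  calc ((criticalProbI 3 : unitInterval) : ℝ) / 162 ^ 3 * (n : ℝ) ^ (-(9 : ℝ))
        = ((criticalProbI 3 : unitInterval) : ℝ) * (1 / (162 * (n : ℝ) ^ 3)) ^ 3 := by
          rw [show (-(9 : ℝ)) = -((9 : ℕ) : ℝ) by norm_num, Real.rpow_neg hn0.le, Real.rpow_natCast]
          field_simp
    _ ≤ ((criticalProbI 3 : unitInterval) : ℝ) * ((1 : ℝ) / (6 * ((box 3 n).card : ℝ))) ^ 3 := by gcongr
    _ ≤ _ := real_pointToPoint hn hx

/-- **van den Berg–Don 2020, Corollary 2, for bond percolation on `ℤ³` at `p_c`**: there is `c > 0` such that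
`P_{p_c}(a ↔ b in Λ_{9n}) ≥ c n^{-9}` for every `n ≥ 1` and all `a, b ∈ Λ_n` (`c = p_c/750³`): `b - a ∈ Λ_{2n}`, Theorem 1 at
scale `2n`, translation by `a` (`real_openConnIn_shift_box`) and `a + Λ_{8n} ⊆ Λ_{9n}` (`image_add_box_subset`, `openConnIn_mono`).
The `e = 9` pair-connection input of Cerf's lossy step (tree W5/F1: `e = 12`, Cerf 2015 Lemma 6.1). [cite: VandenbergDon2020, Corollary 2] -/
theorem critPairConnLower9 :
    ∃ c : ℝ, 0 < c ∧ ∀ n : ℕ, 1 ≤ n → ∀ a ∈ box 3 n, ∀ b ∈ box 3 n,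
      c * (n : ℝ) ^ (-(9 : ℝ)) ≤
        (bondPercolation (zdGraph 3) (criticalProbI 3)).real (openConnIn (↑(box 3 (9 * n)) : Set (Site 3)) a b) := by
  classical
  have hp0 : 0 < ((criticalProbI 3 : unitInterval) : ℝ) := by
    rw [coe_criticalProbI]; exact (Grimmett1999_criticalProb_pos_lt_one_holds 3 (by norm_num)).1
  refine ⟨((criticalProbI 3 : unitInterval) : ℝ) / 750 ^ 3, by positivity, ?_⟩
  intro n hn a ha b hb
  have hn0 : (0 : ℝ) < n := by exact_mod_cast hn
  have hy : b - a ∈ box 3 (2 * n) := by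
    rw [mem_box] at ha hb ⊢
    intro i
    have h1 := ha i
    have h2 := hb i
    simp only [Pi.sub_apply]
    push_cast
    constructor <;> linarith
  have h2n : 1 ≤ 2 * n := by omega
  have key := real_pointToPoint h2n hy
  rw [show 4 * (2 * n) = 8 * n by ring] at key
  have hshift := Literature.Barriers.CriticalPhenomena.real_openConnIn_shift_box (criticalProbI 3) a (b - a) (8 * n)
  rw [sub_add_cancel] at hshift
  have hsub : (zdShiftIso a) '' (↑(box 3 (8 * n)) : Set (Site 3)) ⊆ ↑(box 3 (9 * n)) := by
    rw [zdShiftIso_image_box]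
    have h := image_add_box_subset (n := 8 * n) ha
    rw [show n + 8 * n = 9 * n by ring] at h
    exact Finset.coe_subset.2 h
  have hmono : (bondPercolation (zdGraph 3) (criticalProbI 3)).real
        (openConnIn ((zdShiftIso a) '' (↑(box 3 (8 * n)) : Set (Site 3))) a b) ≤
      (bondPercolation (zdGraph 3) (criticalProbI 3)).real (openConnIn (↑(box 3 (9 * n)) : Set (Site 3)) a b) :=
    measureReal_mono (openConnIn_mono hsub a b) (measure_ne_top _ _)
  have hq := q_two_mul_ge hn
  have hq0 : (0 : ℝ) ≤ 1 / (750 * (n : ℝ) ^ 3) := by positivity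
  calc ((criticalProbI 3 : unitInterval) : ℝ) / 750 ^ 3 * (n : ℝ) ^ (-(9 : ℝ))
        = ((criticalProbI 3 : unitInterval) : ℝ) * (1 / (750 * (n : ℝ) ^ 3)) ^ 3 := by
          rw [show (-(9 : ℝ)) = -((9 : ℕ) : ℝ) by norm_num, Real.rpow_neg hn0.le, Real.rpow_natCast]
          field_simp
    _ ≤ ((criticalProbI 3 : unitInterval) : ℝ) * ((1 : ℝ) / (6 * ((box 3 (2 * n)).card : ℝ))) ^ 3 := by gcongr
    _ ≤ (bondPercolation (zdGraph 3) (criticalProbI 3)).real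
          (openConnIn (↑(box 3 (8 * n)) : Set (Site 3)) 0 (b - a)) := key
    _ = (bondPercolation (zdGraph 3) (criticalProbI 3)).real
          (openConnIn ((zdShiftIso a) '' (↑(box 3 (8 * n)) : Set (Site 3))) a b) := hshift.symm
    _ ≤ _ := hmono

end Summit.CriticalPhenomena.PercolationContinuityZ3.Theorems

end
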